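import Literature.NumberTheory.Automorphic.ClozelCArithmetic
import Mathlib.FieldTheory.IntermediateField.Basic
import Mathlib.RingTheory.IntegralClosure.IsIntegralClosure.Basic
import Mathlib.LinearAlgebra.FreeModule.Finite.Basic
import HarnessLib

/-!
# `IrreducibilityBySelfDuality.HeckeEigenvalueField`: identity with Clozel's theorem, and the
# reduction to a rational finite-dimensional Hecke module
(item stmt-Langlands-13632 `HeckeEigenvalueField`, support, rank 1, route
`route-Langlands-IrreducibilityBySelfDuality`; `--supports` file, theorems only)

The route's input item `HeckeEigenvalueField` — for `π` regular algebraic cuspidal on `GL_n(𝔸_K)`,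
`K` ANY number field, one number field `E ⊂ ℂ` contains the unramified Hecke eigenvalues
`t_{v,i} = q_v^{i(n-i)/2} e_i(α)` at all but finitely many `v` — is Clozel 1990, Thm. 3.13 in the
form used by Böckle–Hui 2025, §3.1, and is, binder for binder, the tree's named fact
`Literature.NumberTheory.Automorphic.Clozel1990_heckeEigenvalueField` (`ClozelAlgebraicity.lean`)
and its second vendoring `Clozel1990_cArithmetic` (`ClozelCArithmetic.lean`): the item spells out
`heckeEigenvalueOf n v α i` as its body `(√q_v)^{i(n-i)} · α.esymm i` (a `δ`-reduction).

## Contents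

1. **Identifications, kernel-checked** (`Iff.rfl`): item ↔ `Clozel1990_heckeEigenvalueField`,
   item ↔ `Clozel1990_cArithmetic`, and the two vendorings ↔ each other; and the **conditional
   closure** `heckeEigenvalueField_of_clozel1990 : Clozel1990_heckeEigenvalueField → item` (a
   `conditional-result`; the discharge `_holds` of the fact — Clozel's cohomological proof,
   (𝔤, K_∞)-cohomology with a rational Betti structure, Clozel 1990 §3.5 / Franke — is not in the
   tree, and nothing short of it proves the item: the carriers `CuspidalAutomorphicRepData`,
   `HasSatakeParamAt` (honest double-coset eigenvalues modulo `W'`), `heckeOperator` (sum over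
   `K gK / K`) and the irreducibility field of `AutomorphicRepData` leave no degenerate reading).
2. **The algebraic half of Clozel's proof, proved.** Clozel §3.5 / Lemme 3.15: a regular algebraic
   cuspidal `π` occurs (after an algebraic twist) in `H^•(S_{K(𝔫)}, V_{E₀}) ⊗_{E₀} ℂ`, a
   finite-dimensional module, RATIONAL over a number field `E₀`, for the integral Hecke operators
   away from `𝔫`, on a common eigenvector with eigenvalues `t_{v,i}`. What turns this into "the
   `t_{v,i}` lie in ONE number field" is linear algebra, proved here in full:
   `exists_numberField_forall_eigenvalue_mem` — for a subfield `E₀ ⊆ ℂ` finite over `ℚ` and a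
   non-zero `x ∈ ℂ^m`, ONE subfield `E ⊆ ℂ` finite over `ℚ` contains every `c` with `T x = c x`
   for some `T ∈ M_m(E₀)` (the matrices having `x` as eigenvector form a finite-dimensional
   `ℚ`-algebra `𝒮`; the eigenvalue is an algebra map `χ : 𝒮 → ℂ`; its range, a finite-dimensional
   domain over `ℚ`, is a field). Hence the **reduction**
   `heckeEigenvalueField_of_rationalHeckeModule`: the item follows from the purely structural
   hypothesis "the eigensystem of every regular algebraic cuspidal `π` is realised, at almost all
   `v`, on one common eigenvector of matrices with entries in one number field" — the exact
   output a future cohomological development must supply.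

All statements are STRUCTURAL (the item's text verbatim over `Literature` imports; this module
does NOT import the Theses file, so a later by-name closure may import it without an import
cycle — the route's kill criterion (e)). Theorems only: no definition, no named fact.
-/

namespace Summit.Langlands.Langlands.Theorems.HeckeEigenvalueField

/-! ### 1. The item is Clozel's theorem (named facts of the tree) -/

section Identification

open Filter Literature.NumberTheory.Automorphic

/-- The input item `IrreducibilityBySelfDuality.HeckeEigenvalueField` (its text verbatim) is
definitionally the named fact `Clozel1990_heckeEigenvalueField` (Clozel 1990, Thm. 3.13, Hecke
eigenvalue form): the item spells out `heckeEigenvalueOf n v α i = (√q_v)^{i(n-i)} · e_i(α)`.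
[cite: Clozel1990, Thm. 3.13] -/
theorem heckeEigenvalueField_iff_clozel1990_heckeEigenvalueField :
    (∀ (n : ℕ) (K : Type) [Field K] [NumberField K] (hcpt : _)
      (π : Literature.NumberTheory.Automorphic.CuspidalAutomorphicRepData n K hcpt),
      π.1.IsRegularAlgebraic → ∃ E : Subfield ℂ, FiniteDimensional ℚ E ∧ ∀ᶠ v in cofinite,
        ∀ α : Multiset ℂ, π.1.HasSatakeParamAt v α → ∀ i ≤ n,
          ((((Real.sqrt (v.residueCard : ℝ)) : ℝ) : ℂ) ^ (i * (n - i))) * α.esymm i ∈ E) ↔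
    Clozel1990_heckeEigenvalueField :=
  Iff.rfl

/-- The input item `IrreducibilityBySelfDuality.HeckeEigenvalueField` (its text verbatim) is
definitionally the second vendoring `Clozel1990_cArithmetic` of the same printed theorem
(Clozel 1990, Thm. 3.13; Böckle–Hui 2025, §3.1 "π is C-arithmetic"). [cite: Clozel1990, Thm. 3.13] -/
theorem heckeEigenvalueField_iff_clozel1990_cArithmetic :
    (∀ (n : ℕ) (K : Type) [Field K] [NumberField K] (hcpt : _)
      (π : Literature.NumberTheory.Automorphic.CuspidalAutomorphicRepData n K hcpt),
      π.1.IsRegularAlgebraic → ∃ E : Subfield ℂ, FiniteDimensional ℚ E ∧ ∀ᶠ v in cofinite,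
        ∀ α : Multiset ℂ, π.1.HasSatakeParamAt v α → ∀ i ≤ n,
          ((((Real.sqrt (v.residueCard : ℝ)) : ℝ) : ℂ) ^ (i * (n - i))) * α.esymm i ∈ E) ↔
    Clozel1990_cArithmetic :=
  Iff.rfl

/-- The two vendorings of Clozel 1990, Thm. 3.13 in Hecke-eigenvalue form that the tree carries
(`Clozel1990_cArithmetic`, `Clozel1990_heckeEigenvalueField`) are the same proposition
(definitionally); recorded so that a discharge of either closes the item. [cite: Clozel1990, Thm. 3.13] -/
theorem clozel1990_cArithmetic_iff_heckeEigenvalueField_fact :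
    Clozel1990_cArithmetic ↔ Clozel1990_heckeEigenvalueField :=
  Iff.rfl

/-- **Conditional closure of the item** (`conditional-result`): under the named fact
`Clozel1990_heckeEigenvalueField` (Clozel 1990, Thm. 3.13: for `π` regular algebraic cuspidal on
`GL_n(𝔸_K)` the unramified Hecke eigenvalues `t_{v,i} = q_v^{i(n-i)/2} e_i(α)`, `v` off a finite
set, lie in one number field `E ⊂ ℂ`), the text of the input item
`IrreducibilityBySelfDuality.HeckeEigenvalueField` holds — by `id`, the two being definitionally
equal. Unconditional discharge needs `Clozel1990_heckeEigenvalueField_holds`, i.e. Clozel's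
cohomological proof, which the tree does not have. [cite: Clozel1990, Thm. 3.13] -/
theorem heckeEigenvalueField_of_clozel1990 (h : Clozel1990_heckeEigenvalueField) :
    ∀ (n : ℕ) (K : Type) [Field K] [NumberField K] (hcpt : _)
      (π : Literature.NumberTheory.Automorphic.CuspidalAutomorphicRepData n K hcpt),
      π.1.IsRegularAlgebraic → ∃ E : Subfield ℂ, FiniteDimensional ℚ E ∧ ∀ᶠ v in cofinite,
        ∀ α : Multiset ℂ, π.1.HasSatakeParamAt v α → ∀ i ≤ n,
          ((((Real.sqrt (v.residueCard : ℝ)) : ℝ) : ℂ) ^ (i * (n - i))) * α.esymm i ∈ E :=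
  h

end Identification

/-! ### 2. The eigenvalue field of a vector (the algebraic half of Clozel's proof) -/

section EigenvalueField

open Matrix

variable {m : Type*} [Fintype m] [DecidableEq m]

/-- Scalars of `ℚ` act on `ℂ^m` through `M_m(E₀) → M_m(ℂ)` as expected:
`(r · 1) x = r x`. [folklore] -/
theorem mapMatrix_algebraMap_mulVec (E₀ : Subfield ℂ) (x : m → ℂ) (r : ℚ) :
    (E₀.subtype.mapMatrix (algebraMap ℚ (Matrix m m E₀) r)) *ᵥ x = (r : ℂ) • x := by
  have h : E₀.subtype.mapMatrix (algebraMap ℚ (Matrix m m E₀) r) =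
      algebraMap ℚ (Matrix m m ℂ) r := by
    rw [RingHom.mapMatrix_apply]
    exact Matrix.map_algebraMap r _ (map_zero _) (by simp)
  rw [h, Matrix.algebraMap_eq_diagonal]
  ext i
  rw [mulVec_diagonal, Pi.algebraMap_apply, eq_ratCast, Pi.smul_apply, smul_eq_mul]

/-- If `T x = c x` and `x i₀ ≠ 0`, the eigenvalue `c` is read off at the coordinate `i₀`:
`c = (T x)_{i₀} / x_{i₀}`. [folklore] -/
theorem div_eq_of_mulVec_eq_smul {E₀ : Subfield ℂ} {x : m → ℂ} {i₀ : m} (hi₀ : x i₀ ≠ 0)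
    {T : Matrix m m E₀} {c : ℂ} (h : (E₀.subtype.mapMatrix T) *ᵥ x = c • x) :
    ((E₀.subtype.mapMatrix T) *ᵥ x) i₀ / x i₀ = c := by
  rw [h, Pi.smul_apply, smul_eq_mul, mul_div_assoc, div_self hi₀, mul_one]

/-- **Eigenvalue field of a vector.** Let `E₀ ⊆ ℂ` be a subfield finite over `ℚ`, `m` a finite
index type and `x : m → ℂ` non-zero. Then there is a subfield `E ⊆ ℂ`, finite over `ℚ`, such that
every `c ∈ ℂ` with `T x = c x` for SOME matrix `T ∈ M_m(E₀)` lies in `E`. Proof: the matrices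
having `x` as an eigenvector form a finite-dimensional `ℚ`-subalgebra `𝒮 ⊆ M_m(E₀)`, the
eigenvalue on `x` is a `ℚ`-algebra map `χ : 𝒮 → ℂ`, and its range — a finite-dimensional
commutative domain over `ℚ` — is a field (`isField_of_isIntegral_of_isField'`); take `E = χ(𝒮)`
(so `[E : ℚ] ≤ m² [E₀ : ℚ]`). This is the linear algebra by which a rational finite-dimensional
Hecke module yields a number field of Hecke eigenvalues (Clozel 1990, proof of Thm. 3.13;
Shimura 1971, Thm. 3.48 for classical forms). [folklore] -/
theorem exists_numberField_forall_eigenvalue_mem (E₀ : Subfield ℂ) [FiniteDimensional ℚ E₀]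
    {x : m → ℂ} (hx : x ≠ 0) :
    ∃ E : Subfield ℂ, FiniteDimensional ℚ E ∧
      ∀ (T : Matrix m m E₀) (c : ℂ), (E₀.subtype.mapMatrix T) *ᵥ x = c • x → c ∈ E := by
  obtain ⟨i₀, hi₀⟩ : ∃ i₀, x i₀ ≠ 0 := Function.ne_iff.mp hx
  -- the eigen-subalgebra `𝒮` of `x` inside `M_m(E₀)`
  let S : Subalgebra ℚ (Matrix m m E₀) :=
    { carrier := {T | ∃ c : ℂ, (E₀.subtype.mapMatrix T) *ᵥ x = c • x}
      mul_mem' := by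
        rintro T U ⟨c, hc⟩ ⟨d, hd⟩
        refine ⟨c * d, ?_⟩
        rw [map_mul, ← mulVec_mulVec, hd, mulVec_smul, hc, smul_smul, mul_comm]
      one_mem' := ⟨1, by rw [map_one, one_mulVec, one_smul]⟩
      add_mem' := by
        rintro T U ⟨c, hc⟩ ⟨d, hd⟩
        exact ⟨c + d, by rw [map_add, add_mulVec, hc, hd, add_smul]⟩
      zero_mem' := ⟨0, by rw [map_zero, zero_mulVec, zero_smul]⟩
      algebraMap_mem' := fun r ↦ ⟨(r : ℂ), mapMatrix_algebraMap_mulVec E₀ x r⟩ }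
  have hmemS : ∀ {T : Matrix m m E₀}, T ∈ S ↔ ∃ c : ℂ, (E₀.subtype.mapMatrix T) *ᵥ x = c • x :=
    Iff.rfl
  -- the eigenvalue on `x`, read off at `i₀`
  let ev : Matrix m m E₀ → ℂ := fun T ↦ ((E₀.subtype.mapMatrix T) *ᵥ x) i₀ / x i₀
  have hev : ∀ {T : Matrix m m E₀} {c : ℂ}, (E₀.subtype.mapMatrix T) *ᵥ x = c • x → ev T = c :=
    fun h ↦ div_eq_of_mulVec_eq_smul hi₀ h
  have hevS : ∀ T : S, (E₀.subtype.mapMatrix (T : Matrix m m E₀)) *ᵥ x = ev T • x := by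
    intro T
    obtain ⟨c, hc⟩ := hmemS.mp T.2
    rw [hev hc, hc]
  -- the eigenvalue character `χ : 𝒮 →ₐ[ℚ] ℂ`
  let χ : S →ₐ[ℚ] ℂ :=
    { toFun := fun T ↦ ev T
      map_one' := hev (c := 1) (by rw [OneMemClass.coe_one, map_one, one_mulVec, one_smul])
      map_mul' := fun T U ↦ hev (by
        rw [MulMemClass.coe_mul, map_mul, ← mulVec_mulVec, hevS U, mulVec_smul, hevS T,
          smul_smul, mul_comm])
      map_zero' := hev (c := 0) (by rw [ZeroMemClass.coe_zero, map_zero, zero_mulVec, zero_smul])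
      map_add' := fun T U ↦ hev (by
        rw [AddMemClass.coe_add, map_add, add_mulVec, hevS T, hevS U, add_smul])
      commutes' := fun r ↦ hev (by
        rw [Subalgebra.coe_algebraMap, mapMatrix_algebraMap_mulVec]
        exact congrArg (· • x) (eq_ratCast (algebraMap ℚ ℂ) r).symm) }
  have hχ : ∀ T : S, χ T = ev T := fun _ ↦ rfl
  -- `𝒮` is finite-dimensional over `ℚ` (inside `M_m(E₀)`), hence so is the range of `χ`
  haveI : FiniteDimensional ℚ S :=
    FiniteDimensional.of_injective S.val.toLinearMap (fun a b h ↦ Subtype.ext h)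
  haveI hfin : FiniteDimensional ℚ χ.range :=
    Module.Finite.of_surjective χ.rangeRestrict.toLinearMap fun y ↦ by
      obtain ⟨a, ha⟩ := χ.mem_range.mp y.2
      exact ⟨a, Subtype.ext ha⟩
  -- a finite-dimensional commutative domain over `ℚ` is a field
  have hfield : IsField χ.range := isField_of_isIntegral_of_isField' (Field.toIsField ℚ)
  refine ⟨(χ.range.toIntermediateField' hfield).toSubfield, hfin, fun T c hT ↦ ?_⟩
  have hmem : T ∈ S := hmemS.mpr ⟨c, hT⟩
  have hc : χ ⟨T, hmem⟩ = c := by rw [hχ]; exact hev hT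
  change c ∈ χ.range
  exact χ.mem_range.mpr ⟨⟨T, hmem⟩, hc⟩

end EigenvalueField

/-! ### 3. The reduction of the item to a rational Hecke module -/

section Reduction

open Filter Matrix Literature.NumberTheory.Automorphic IsDedekindDomain NumberField

/-- **`HeckeEigenvalueField` from a rational finite-dimensional Hecke module** (the algebraic
skeleton of Clozel 1990, Thm. 3.13, §3.5: cuspidal cohomology with coefficients defined over a
number field `E₀`). Hypothesis (the cohomological input, NOT in the tree): for every regular
algebraic cuspidal `π` on `GL_n(𝔸_K)` there are a subfield `E₀ ⊆ ℂ` finite over `ℚ`, a dimension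
`d` and a non-zero `x ∈ ℂ^d` such that for all but finitely many finite places `v`, for every
Satake parameter `α` of `π` at `v` and every `i ≤ n`, the Hecke eigenvalue
`t_{v,i} = (√q_v)^{i(n-i)} e_i(α)` is the eigenvalue on `x` of some `d × d` matrix with entries in
`E₀`. Conclusion: the text of the input item `IrreducibilityBySelfDuality.HeckeEigenvalueField`
(= `Clozel1990_heckeEigenvalueField`), by `exists_numberField_forall_eigenvalue_mem`.
[cite: Clozel1990, Thm. 3.13 and Lemme 3.15] -/
theorem heckeEigenvalueField_of_rationalHeckeModule
    (H : ∀ (n : ℕ) (K : Type) [Field K] [NumberField K] (hcpt : isCompact_glFiniteIntegralLevel n K)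
      (π : CuspidalAutomorphicRepData n K hcpt), π.1.IsRegularAlgebraic →
      ∃ (E₀ : Subfield ℂ) (_ : FiniteDimensional ℚ E₀) (d : ℕ) (x : Fin d → ℂ), x ≠ 0 ∧
        ∀ᶠ v : HeightOneSpectrum (𝓞 K) in cofinite, ∀ α : Multiset ℂ,
          π.1.HasSatakeParamAt v α → ∀ i ≤ n, ∃ T : Matrix (Fin d) (Fin d) E₀,
            (E₀.subtype.mapMatrix T) *ᵥ x =
              (((((Real.sqrt (v.residueCard : ℝ)) : ℝ) : ℂ) ^ (i * (n - i))) * α.esymm i) • x) :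
    ∀ (n : ℕ) (K : Type) [Field K] [NumberField K] (hcpt : _)
      (π : Literature.NumberTheory.Automorphic.CuspidalAutomorphicRepData n K hcpt),
      π.1.IsRegularAlgebraic → ∃ E : Subfield ℂ, FiniteDimensional ℚ E ∧ ∀ᶠ v in cofinite,
        ∀ α : Multiset ℂ, π.1.HasSatakeParamAt v α → ∀ i ≤ n,
          ((((Real.sqrt (v.residueCard : ℝ)) : ℝ) : ℂ) ^ (i * (n - i))) * α.esymm i ∈ E := by
  intro n K _ _ hcpt π hπ
  obtain ⟨E₀, hE₀, d, x, hx, hv⟩ := H n K hcpt π hπ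
  obtain ⟨E, hE, hmem⟩ := exists_numberField_forall_eigenvalue_mem E₀ hx
  refine ⟨E, hE, ?_⟩
  filter_upwards [hv] with v hv α hα i hi
  obtain ⟨T, hT⟩ := hv α hα i hi
  exact hmem T _ hT

/-- The same reduction with the named fact as conclusion: a rational finite-dimensional Hecke
module for every regular algebraic cuspidal `π` DISCHARGES `Clozel1990_heckeEigenvalueField`
(and with it the item and `Clozel1990_cArithmetic`). [cite: Clozel1990, Thm. 3.13 and Lemme 3.15] -/
theorem clozel1990_heckeEigenvalueField_of_rationalHeckeModule
    (H : ∀ (n : ℕ) (K : Type) [Field K] [NumberField K] (hcpt : isCompact_glFiniteIntegralLevel n K)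
      (π : CuspidalAutomorphicRepData n K hcpt), π.1.IsRegularAlgebraic →
      ∃ (E₀ : Subfield ℂ) (_ : FiniteDimensional ℚ E₀) (d : ℕ) (x : Fin d → ℂ), x ≠ 0 ∧
        ∀ᶠ v : HeightOneSpectrum (𝓞 K) in cofinite, ∀ α : Multiset ℂ,
          π.1.HasSatakeParamAt v α → ∀ i ≤ n, ∃ T : Matrix (Fin d) (Fin d) E₀,
            (E₀.subtype.mapMatrix T) *ᵥ x =
              (((((Real.sqrt (v.residueCard : ℝ)) : ℝ) : ℂ) ^ (i * (n - i))) * α.esymm i) • x) :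
    Clozel1990_heckeEigenvalueField :=
  heckeEigenvalueField_of_rationalHeckeModule H

end Reduction

end Summit.Langlands.Langlands.Theorems.HeckeEigenvalueField
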